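import Literature.AlgebraicGeometry.ShimuraVarieties.HeckeCorrespondenceAction

/-!
# The archimedean boundedness of contact elements, assembled from its bricks (crux
# `EndoscopicMiddleDegree.OrthogonalEnveloped`, stmt-HodgeConjecture-14300; `--supports`; seat c2, 2026-08-16)

`stub_archimedeanBound` (for compact `K, L ⊆ 𝔹`, every `γ ∈ Γ` with `γK ∩ L ≠ ∅` has all conjugates of
all entries bounded) is the archimedean half of `stub_properlyDiscontinuous` (assembly landed p108067; the
discreteness half `stub_congruenceBoundedFinite` landed p108331). This file ASSEMBLES it from three inputs
taken as hypotheses: (def) `stub_definiteUnitaryBounded` (landed p108224) for the embeddings off the place of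
`τ₁` (there `H^τ` is positive definite, `posDef_of_ne`); (syl) the conclusion of `stub_sylvesterEntryBound`
(landed p108321, fed by `stub_indefiniteUnitaryEntryBound` p107948) for `τ₁` and its conjugate, using the
datum's Sylvester normalisation `signature_τ₁` and the isometry identity `conjTranspose_mul_Hℂ_mul`; and
(corner) the registered OPEN brick `stub_cornerBound` (the corner entry of `T⁻¹ γ^{τ₁} T` is bounded over the
contact elements). With it, `stub_properlyDiscontinuous` waits on `stub_cornerBound` ALONE.

* `stub_archimedeanBoundOfBricks` (REGISTERED stub of the crux).

References: A. Borel, *Introduction aux groupes arithmétiques* (1969), §8; BMM arXiv:1306.1515 Part 2 §§1.1–1.4.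
-/

noncomputable section

-- The crux-workfile namespace `Summit.<P>.<Sub>.Cruxes.…` repeats `HodgeConjecture` (single-conjunct summit).
set_option linter.dupNamespace false

namespace Summit.HodgeConjecture.HodgeConjecture.Cruxes.OrthogonalEnveloped.HeckeGraphChow

open scoped BigOperators ComplexConjugate ComplexOrder
open Matrix NumberField
open Literature.AlgebraicGeometry.Motives (SchemeOver)
open Literature.AlgebraicGeometry.ShimuraVarieties

/-- **Isometries stay isometries under every complex embedding**: for `γ ∈ U(V)(F)` and `τ : E → ℂ`,
`(γ^τ)ᴴ H^τ γ^τ = H^τ` (apply `τ` to `(σγ)ᵀ H γ = H`; `τ ∘ σ = conj ∘ τ`). The case `τ = τ₁` is the tree's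
`conjTranspose_mul_Hℂ_mul`. [cite: BergeronMillsonMoeglin2016Balls, Part 2 §1.2] -/
theorem conjTranspose_map_mul_map_mul {p : ℕ} {X : SchemeOver ℂ} (D : UnitaryBallQuotientDatum p X)
    (τ : D.E →+* ℂ) {γ : GL (Fin (p + 1)) D.E} (hγ : γ ∈ unitaryGroup (conjRingHom D.E) D.H) :
    ((γ : Matrix (Fin (p + 1)) (Fin (p + 1)) D.E).map τ)ᴴ * D.H.map τ *
      (γ : Matrix (Fin (p + 1)) (Fin (p + 1)) D.E).map τ = D.H.map τ := by
  have h := congrArg (fun M : Matrix (Fin (p + 1)) (Fin (p + 1)) D.E ↦ M.map τ)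
    (mem_unitaryGroup_iff.1 hγ)
  simp only [Matrix.map_mul] at h
  have ht : (((γ : Matrix (Fin (p + 1)) (Fin (p + 1)) D.E).map (conjRingHom D.E))ᵀ).map τ =
      ((γ : Matrix (Fin (p + 1)) (Fin (p + 1)) D.E).map τ)ᴴ := by
    ext i j
    simp only [Matrix.map_apply, transpose_apply, conjTranspose_apply, Complex.star_def,
      embedding_conjRingHom]
  rwa [ht] at h

/-- **REGISTERED STUB `stub_archimedeanBoundOfBricks` (seat c2): the archimedean bound from its three
bricks.** [cite: BergeronMillsonMoeglin2016Balls, Part 2 §1.4] -/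
theorem stub_archimedeanBoundOfBricks :
    (∀ (n : ℕ) (Hc : Matrix (Fin n) (Fin n) ℂ), Hc.PosDef →
      ∃ C : ℝ, ∀ g : Matrix (Fin n) (Fin n) ℂ, gᴴ * Hc * g = Hc → ∀ i j, ‖g i j‖ ≤ C) →
    (∀ (p : ℕ) (Hc : Matrix (Fin (p + 1)) (Fin (p + 1)) ℂ) (T : GL (Fin (p + 1)) ℂ),
      (T : Matrix (Fin (p + 1)) (Fin (p + 1)) ℂ)ᴴ * Hc * (T : Matrix (Fin (p + 1)) (Fin (p + 1)) ℂ) =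
        signatureMatrix p →
      ∃ C : ℝ, ∀ γ : GL (Fin (p + 1)) ℂ,
        (γ : Matrix (Fin (p + 1)) (Fin (p + 1)) ℂ)ᴴ * Hc * (γ : Matrix (Fin (p + 1)) (Fin (p + 1)) ℂ) =
          Hc →
        ∀ i j, ‖(γ : Matrix (Fin (p + 1)) (Fin (p + 1)) ℂ) i j‖ ≤
          C * ‖((T⁻¹ * γ * T : GL (Fin (p + 1)) ℂ) : Matrix (Fin (p + 1)) (Fin (p + 1)) ℂ)
            (Fin.last p) (Fin.last p)‖) →
    (∀ {p : ℕ} {X : SchemeOver ℂ} (D : UnitaryBallQuotientDatum p X) (T : GL (Fin (p + 1)) ℂ),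
      (T : Matrix (Fin (p + 1)) (Fin (p + 1)) ℂ)ᴴ * D.Hℂ * (T : Matrix (Fin (p + 1)) (Fin (p + 1)) ℂ) =
        signatureMatrix p →
      ∀ (K L : Set D.ball), IsCompact K → IsCompact L →
        ∃ C : ℝ, ∀ γ : ↥D.Γ, (∃ b ∈ K, γ • b ∈ L) →
          ‖((T⁻¹ * Matrix.GeneralLinearGroup.map D.τ₁ (γ : GL (Fin (p + 1)) D.E) * T :
              GL (Fin (p + 1)) ℂ) : Matrix (Fin (p + 1)) (Fin (p + 1)) ℂ) (Fin.last p) (Fin.last p)‖ ≤ C) →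
    ∀ {p : ℕ} {X : SchemeOver ℂ} (D : UnitaryBallQuotientDatum p X) (K L : Set D.ball),
      IsCompact K → IsCompact L →
      ∃ C : ℝ, ∀ γ : ↥D.Γ, (∃ b ∈ K, γ • b ∈ L) →
        ∀ (τ : D.E →+* ℂ) (i j : Fin (p + 1)), ‖τ ((γ : GL (Fin (p + 1)) D.E) i j)‖ ≤ C := by
  intro hdef hsyl hcorner p X D K L hK hL
  classical
  -- Sylvester normalisation at `τ₁`, the corner bound and the conjugation bound
  obtain ⟨T, hT⟩ := D.signature_τ₁
  obtain ⟨C₁, hC₁⟩ := hcorner D T hT K L hK hL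
  obtain ⟨C₂, hC₂⟩ := hsyl p D.Hℂ T hT
  -- the bounds at the definite places
  have hoff : ∀ τ : D.E →+* ℂ, InfinitePlace.mk τ ≠ InfinitePlace.mk D.τ₁ →
      ∃ C : ℝ, ∀ g : Matrix (Fin (p + 1)) (Fin (p + 1)) ℂ, gᴴ * D.H.map τ * g = D.H.map τ →
        ∀ i j, ‖g i j‖ ≤ C :=
    fun τ hτ ↦ hdef (p + 1) (D.H.map τ) (D.posDef_of_ne τ hτ)
  let Coff : (D.E →+* ℂ) → ℝ := fun τ ↦
    if hτ : InfinitePlace.mk τ ≠ InfinitePlace.mk D.τ₁ then |Classical.choose (hoff τ hτ)| else 0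
  have hCoff_nonneg : ∀ τ, 0 ≤ Coff τ := fun τ ↦ by
    simp only [Coff]
    split_ifs
    · exact abs_nonneg _
    · exact le_rfl
  refine ⟨|C₂| * max C₁ 0 + ∑ τ, Coff τ, fun γ hγ τ i j ↦ ?_⟩
  have hsum_nonneg : 0 ≤ ∑ τ, Coff τ := Finset.sum_nonneg fun τ _ ↦ hCoff_nonneg τ
  have hfirst_nonneg : 0 ≤ |C₂| * max C₁ 0 := mul_nonneg (abs_nonneg _) (le_max_right _ _)
  have hunit : γ.1 ∈ unitaryGroup (conjRingHom D.E) D.H := D.isCongruenceSubgroup.1 γ.2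
  by_cases hτ : InfinitePlace.mk τ = InfinitePlace.mk D.τ₁
  · -- the place of `τ₁`: `τ = τ₁` or `τ = conj ∘ τ₁`, same norms
    have hnorm : ‖τ ((γ : GL (Fin (p + 1)) D.E) i j)‖ = ‖D.τ₁ ((γ : GL (Fin (p + 1)) D.E) i j)‖ := by
      rcases InfinitePlace.mk_eq_iff.1 hτ with h | h
      · rw [h]
      · rw [← h, ComplexEmbedding.conjugate_coe_eq, Complex.norm_conj]
    rw [hnorm]
    -- `γ^{τ₁}` as an element of `GL_{p+1}(ℂ)`
    set g : GL (Fin (p + 1)) ℂ := Matrix.GeneralLinearGroup.map D.τ₁ (γ : GL (Fin (p + 1)) D.E) with hg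
    have hgm : (g : Matrix (Fin (p + 1)) (Fin (p + 1)) ℂ) =
        ((γ : GL (Fin (p + 1)) D.E) : Matrix (Fin (p + 1)) (Fin (p + 1)) D.E).map D.τ₁ := rfl
    have hgu : (g : Matrix (Fin (p + 1)) (Fin (p + 1)) ℂ)ᴴ * D.Hℂ *
        (g : Matrix (Fin (p + 1)) (Fin (p + 1)) ℂ) = D.Hℂ := by
      rw [hgm]
      exact D.conjTranspose_mul_Hℂ_mul hunit
    have h1 : ‖D.τ₁ ((γ : GL (Fin (p + 1)) D.E) i j)‖ = ‖(g : Matrix (Fin (p + 1)) (Fin (p + 1)) ℂ) i j‖ := by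
      rw [hgm, Matrix.map_apply]
    rw [h1]
    have h2 := hC₂ g hgu i j
    have h3 := hC₁ γ hγ
    calc ‖(g : Matrix (Fin (p + 1)) (Fin (p + 1)) ℂ) i j‖
        ≤ C₂ * ‖((T⁻¹ * g * T : GL (Fin (p + 1)) ℂ) : Matrix (Fin (p + 1)) (Fin (p + 1)) ℂ)
            (Fin.last p) (Fin.last p)‖ := h2
      _ ≤ |C₂| * max C₁ 0 := by
          refine (mul_le_mul_of_nonneg_right (le_abs_self C₂) (norm_nonneg _)).trans ?_
          exact mul_le_mul_of_nonneg_left (h3.trans (le_max_left _ _)) (abs_nonneg _)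
      _ ≤ |C₂| * max C₁ 0 + ∑ τ, Coff τ := le_add_of_nonneg_right hsum_nonneg
  · -- a definite place
    obtain hC := Classical.choose_spec (hoff τ hτ)
    have hgu := conjTranspose_map_mul_map_mul D τ hunit
    have h1 : ‖τ ((γ : GL (Fin (p + 1)) D.E) i j)‖ =
        ‖(((γ : GL (Fin (p + 1)) D.E) : Matrix (Fin (p + 1)) (Fin (p + 1)) D.E).map τ) i j‖ := by
      rw [Matrix.map_apply]
    rw [h1]
    have h2 := hC _ hgu i j
    have h3 : Classical.choose (hoff τ hτ) ≤ Coff τ := by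
      simp only [Coff, dif_pos hτ]
      exact le_abs_self _
    have h4 : Coff τ ≤ ∑ τ, Coff τ := Finset.single_le_sum (fun τ _ ↦ hCoff_nonneg τ) (Finset.mem_univ τ)
    linarith

end Summit.HodgeConjecture.HodgeConjecture.Cruxes.OrthogonalEnveloped.HeckeGraphChow

end
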